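import Literature.NumberTheory.EllipticCurves.PAdicLFunctionProofs
import Literature.NumberTheory.EllipticCurves.ModularSymbolsProofs
import Literature.NumberTheory.EllipticCurves.ModularSymbolsHeckeProofs
import Literature.NumberTheory.EllipticCurves.HeckeOperatorsProofs
import HarnessLib

/-!
# The Mazur–Swinnerton-Dyer measure is a bounded distribution: discharge of
# `msdMeasure_distribution` and `exists_norm_msdMeasure_le` modulo Eichler–Shimura and
# Manin–Drinfeld (trunk EllArithM, items C9, C19)

D-0014 keeps `Literature/` sorry-free by stating cited results as named facts `def X : Prop`.
This sibling file of `Literature.NumberTheory.EllipticCurves.PAdicLFunction` reduces the two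
analytic inputs of the `p`-adic `L`-function `L_p(f, α, T) = ∫ (1+T)^{ℓ(x)} dμ_{f,α}` of a rational
newform `f ∈ S₂(Γ₀(N))` — the **distribution relation** `msdMeasure_distribution` and the
**boundedness** `exists_norm_msdMeasure_le` of the Mazur–Swinnerton-Dyer measure
`μ_{f,α}(a + pⁿℤ_p) = α⁻ⁿ [a/pⁿ]⁺ - α⁻ⁿ⁻¹ [a/pⁿ⁻¹]⁺` (Mazur–Tate–Teitelbaum 1986, §I.10) — to the
two remaining structural facts on modular symbols of `Literature.NumberTheory.EllipticCurves.
ModularSymbols`: `isZLattice_periodLattice` (Eichler–Shimura: `Λ_f` is a lattice) and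
`exists_nsmul_modularSymbol_mem_periodLattice` (Manin–Drinfeld: `{∞, r}_f ∈ ℚ ⊗ Λ_f`). On the way
it discharges outright the named facts `modularSymbol_neg_eq_conj`, `plusSymbol_eq_re`,
`minusSymbol_eq_im_mul_I`, `conj_mem_periodLattice` (`ModularSymbols`) and
`IsNewform0.heckeEigenvalue_eq_coeff` (`Newforms`).

## Main results

* `modularSymbol_neg_eq_conj_holds`, `plusSymbol_eq_re_holds`, `minusSymbol_eq_im_mul_I_holds`:
  `{∞, -r}_f = conj {∞, r}_f` for `f` with real Fourier coefficients (conjugate the `q`-expansion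
  along the ray `r + it`; Manin 1972, §1.6; Cremona 1997, §2.1.4, §2.8).
* `conj_mem_periodLattice_holds`: `Λ̄_f = Λ_f` for a rational newform: on generators
  `conj {∞, γ∞} = {∞, γ'∞}` with `γ' = εγε`, `ε = diag(-1, 1)` (Cremona §2.6; Manin §1.6).
* `IsNewform0.heckeEigenvalue_eq_coeff_holds`: `T_p f = a_p(f) f` for a newform and every prime
  `p` (Atkin–Lehner 1970, Thm. 3; Diamond–Shurman Prop. 5.8.5): compare the coefficients of `q¹`
  in `T_p f = λ f` using `a₁(T_p f) = a_p(f)` (`qExpansion_coeff_heckeT_holds`,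
  `HeckeOperatorsProofs`) and `a₁(f) = 1`.
* `modularSymbol_heckeT`, `cuspCoeff_mul_modularSymbol`, `cuspCoeff_mul_plusSymbol`,
  `intCast_mul_ratPlusSymbol`: **the Hecke relation for modular symbols**
  `a_p {∞, r} = ∑_{j mod p} {∞, (r + j)/p} + {∞, p r}` for `p ∤ N`
  (Mazur–Tate–Teitelbaum 1986, §I.4 (4.2); Cremona §2.9), from Diamond–Shurman Prop. 5.2.1
  (`T_p f = ∑ⱼ f ∣[2] (1 j; 0 p) + f ∣[2] diag(p, 1)`, `coe_heckeT_gamma0_eq_sum` of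
  `HeckeOperatorsProofs`) by the substitutions `t ↦ t/p`, `t ↦ pt` in the ray integrals.
* `exists_forall_nsmul_modularSymbol_mem_periodLattice`: **uniform Manin–Drinfeld
  denominators** — one `n > 0` with `n {∞, r}_f ∈ Λ_f` for all `r`, from the pointwise statement,
  the finiteness of `Γ₀(N) \ SL(2, ℤ)` (Mathlib) and Manin's relation `{∞, γs} = {∞, γ∞} + {∞, s}`
  (`modularSymbol_gamma0_smul_holds`, `ModularSymbolsProofs`).
* `exists_forall_ratPlusSymbol_eq_div`, `ratCast_ratPlusSymbol_of_lattice`,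
  `ratCast_ratPlusSymbol_of`: for a rational newform, `[r]⁺_f = re plusSymbol(r)/Ω⁺ ∈ (1/D)ℤ`
  for one `D > 0` (bounded denominators), and the named fact `ratCast_ratPlusSymbol`
  (`([r]⁺ : ℝ) = [r]`), given Eichler–Shimura and Manin–Drinfeld.
* `exists_norm_msdMeasure_le_of_lattice`, `exists_norm_msdMeasure_le_of`: **`μ_{f,α}` is bounded**
  for `|α|_p = 1` (the statement of the named fact `exists_norm_msdMeasure_le`; Delbourgo 2008,
  Thm. 2.2; Mazur–Tate–Teitelbaum §I.11), with `C = 2 |1/D|_p`.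
* `sum_fiber_msdMeasure_succ_eq`, `msdMeasure_distribution_of`: **the distribution relation**
  `∑_{b ≡ a (pⁿ)} μ(b + pⁿ⁺¹ℤ_p) = μ(a + pⁿℤ_p)` (Mazur–Tate–Teitelbaum 1986, §I.10 Prop. (10.2);
  Mazur–Swinnerton-Dyer 1974, §8) from the Hecke relation and `α² - a_p α + p = 0`, i.e. the
  named fact `msdMeasure_distribution`, given Eichler–Shimura and Manin–Drinfeld.

## References

* B. Mazur, J. Tate, J. Teitelbaum, *On `p`-adic analogues of the conjectures of Birch and
  Swinnerton-Dyer*, Invent. Math. 84 (1986), 1–48, §I.4 (4.2), §I.8, §I.10 (10.1)–(10.2), §I.11.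
* B. Mazur, P. Swinnerton-Dyer, *Arithmetic of Weil curves*, Invent. Math. 25 (1974), §8.
* Ju. I. Manin, *Parabolic points and zeta functions of modular curves*, Izv. Akad. Nauk SSSR 36
  (1972), §1.5–1.6, Prop. 1.4, Cor. 3.6.
* J. E. Cremona, *Algorithms for modular elliptic curves*, 2nd ed., CUP 1997, §2.1–2.2, §2.6,
  §2.8, §2.9.
* A. O. L. Atkin, J. Lehner, *Hecke operators on `Γ₀(m)`*, Math. Ann. 185 (1970), Thm. 3.
* F. Diamond, J. Shurman, *A first course in modular forms*, GTM 228, Prop. 5.2.1, 5.2.2, 5.8.5.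
* D. Delbourgo, *Elliptic curves and big Galois representations*, LMS Lecture Note Ser. 356, CUP
  2008, §2.1, Thm. 2.2.
-/

noncomputable section

open scoped MatrixGroups ModularForm

open CongruenceSubgroup UpperHalfPlane Complex Set MeasureTheory Filter Topology Literature.NumberTheory.EllipticCurves.ModularForms

namespace Literature.NumberTheory.EllipticCurves.ModularForms

/-! ### Conjugation: `{∞, -r}_f = conj {∞, r}_f` and `Λ̄_f = Λ_f` -/

section Conjugation

variable {N : ℕ} [NeZero N] (f : CuspForm (Gamma0 N) 2)

/-- For `t > 0`, `f(x + it) = ∑ aₙ e^{2πin(x + it)}` (`q`-expansion at the point `x + it`).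
[folklore] -/
theorem hasSum_apply_ofComplex (x : ℝ) {t : ℝ} (ht : 0 < t) :
    HasSum
      (fun n : ℕ ↦
        cuspCoeff f n * Complex.exp (2 * Real.pi * Complex.I * ((x : ℂ) + t * Complex.I)) ^ n)
      (f (ofComplex ((x : ℂ) + t * Complex.I))) := by
  have ht' : 0 < ((x : ℂ) + t * Complex.I).im := by simpa using ht
  have h := UpperHalfPlane.hasSum_qExpansion one_pos
    (SlashInvariantFormClass.periodic_comp_ofComplex f (h := 1) (by simp))
    (ModularFormClass.holo f) (ModularFormClass.bdd_at_infty f) ⟨_, ht'⟩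
  rw [ofComplex_apply_of_im_pos ht']
  convert h using 2 with n
  simp [Function.Periodic.qParam, cuspCoeff, smul_eq_mul]

/-- **Discharge of `modularSymbol_neg_eq_conj`**: if all `aₙ(f)` are real then
`f(-x + it) = conj f(x + it)` (conjugate the `q`-expansion), hence `{∞, -r}_f = conj {∞, r}_f`
(Manin 1972, §1.6; Cremona 1997, §2.1.4). [cite: Manin1972, §1.6] -/
theorem modularSymbol_neg_eq_conj_holds : modularSymbol_neg_eq_conj f := by
  intro hreal r
  have hpt : ∀ t : ℝ, 0 < t → f (ofComplex (-(r : ℂ) + t * Complex.I)) =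
      starRingEnd ℂ (f (ofComplex ((r : ℂ) + t * Complex.I))) := by
    intro t ht
    have h1 := hasSum_apply_ofComplex f (-(r : ℝ)) ht
    have h2 := (hasSum_apply_ofComplex f (r : ℝ) ht)
    rw [← Complex.hasSum_conj'] at h2
    push_cast at h1 h2
    refine h1.unique ?_
    convert h2 using 2 with n
    rw [map_mul, map_pow, ← Complex.exp_conj]
    congr 2
    · exact (Complex.conj_eq_iff_im.mpr (hreal n)).symm
    · simp only [map_mul, map_add, Complex.conj_ofReal, Complex.conj_I, map_ofNat, map_ratCast]
      ring_nf
  simp only [modularSymbol, map_mul, map_ofNat, Complex.conj_ofReal]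
  rw [← integral_conj]
  push_cast
  congr 1
  exact setIntegral_congr_fun measurableSet_Ioi fun t ht ↦ hpt t ht

/-- **Discharge of `plusSymbol_eq_re`**: `plusSymbol f r = re {∞, r}_f` for real-coefficient `f`
(via `plusSymbol_eq_re_of`; Cremona 1997, §2.8). [cite: CremonaAlgorithms1997, §2.8] -/
theorem plusSymbol_eq_re_holds : plusSymbol_eq_re f :=
  plusSymbol_eq_re_of f (modularSymbol_neg_eq_conj_holds f)

/-- **Discharge of `minusSymbol_eq_im_mul_I`**: `minusSymbol f r = i · im {∞, r}_f` for
real-coefficient `f` (via `minusSymbol_eq_im_mul_I_of`; Cremona 1997, §2.8).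
[cite: CremonaAlgorithms1997, §2.8] -/
theorem minusSymbol_eq_im_mul_I_holds : minusSymbol_eq_im_mul_I f :=
  minusSymbol_eq_im_mul_I_of f (modularSymbol_neg_eq_conj_holds f)

variable {f}

/-- For `f` with real coefficients, `conj {∞, γ∞}_f = {∞, γ'∞}_f` with `γ' = εγε ∈ Γ₀(N)`,
`ε = diag(-1, 1)`: `γ' = (a -b; -c d)` for `γ = (a b; c d)`, `γ'∞ = -γ∞`
(Cremona 1997, §2.6; Manin 1972, §1.6). [cite: Manin1972, §1.6] -/
theorem exists_cuspSymbol_eq_conj (h : ∀ n, (cuspCoeff f n).im = 0) (γ : Gamma0 N) :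
    ∃ γ' : Gamma0 N, cuspSymbol f γ' = starRingEnd ℂ (cuspSymbol f γ) := by
  have hdet :
      (γ : SL(2, ℤ)) 0 0 * (γ : SL(2, ℤ)) 1 1 - (γ : SL(2, ℤ)) 0 1 * (γ : SL(2, ℤ)) 1 0 = 1 := by
    have := Matrix.det_fin_two (γ : SL(2, ℤ)).1
    rw [(γ : SL(2, ℤ)).2] at this
    linear_combination -this
  let M : SL(2, ℤ) := ⟨!![(γ : SL(2, ℤ)) 0 0, -((γ : SL(2, ℤ)) 0 1);
      -((γ : SL(2, ℤ)) 1 0), (γ : SL(2, ℤ)) 1 1], by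
    rw [Matrix.det_fin_two_of]; linear_combination hdet⟩
  have hM : M ∈ Gamma0 N := by
    rw [Gamma0_mem]
    have hγ := Gamma0_mem.mp γ.2
    simp only [M, Matrix.of_apply, Matrix.cons_val', Matrix.cons_val_zero, Matrix.cons_val_one,
      Int.cast_neg, hγ, neg_zero]
  refine ⟨⟨M, hM⟩, ?_⟩
  have h00 : ((⟨M, hM⟩ : Gamma0 N) : SL(2, ℤ)) 0 0 = (γ : SL(2, ℤ)) 0 0 := rfl
  have h10 : ((⟨M, hM⟩ : Gamma0 N) : SL(2, ℤ)) 1 0 = -((γ : SL(2, ℤ)) 1 0) := rfl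
  unfold cuspSymbol
  rw [h00, h10]
  by_cases hc : (γ : SL(2, ℤ)) 1 0 = 0
  · rw [if_pos hc, if_pos (neg_eq_zero.mpr hc), map_zero]
  · rw [if_neg hc, if_neg (neg_eq_zero.not.mpr hc), ← modularSymbol_neg_eq_conj_holds f h,
      Int.cast_neg, div_neg]

/-- **Discharge of `conj_mem_periodLattice`** (`Λ̄_f = Λ_f` for a rational newform): the Fourier
coefficients of `f` are rational, hence real (`cuspCoeff_im_eq_zero_of_coeffField_eq_bot`), so on
generators `conj {∞, γ∞}_f = {∞, γ'∞}_f ∈ Λ_f` (`exists_cuspSymbol_eq_conj`), and conjugation is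
additive (Cremona 1997, §2.6, §2.8; Manin 1972, §1.6). [cite: Manin1972, §1.6] -/
theorem conj_mem_periodLattice_holds : conj_mem_periodLattice (f := f) := by
  intro _ hQ z hz
  have h : ∀ n, (cuspCoeff f n).im = 0 := Literature.NumberTheory.EllipticCurves.cuspCoeff_im_eq_zero_of_coeffField_eq_bot hQ
  induction hz using AddSubgroup.closure_induction with
  | mem x hx =>
    obtain ⟨γ, rfl⟩ := hx
    obtain ⟨γ', hγ'⟩ := exists_cuspSymbol_eq_conj h γ
    rw [← hγ']
    exact cuspSymbol_mem_periodLattice f _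
  | zero => rw [map_zero]; exact zero_mem _
  | add x y _ _ hx hy => rw [map_add]; exact add_mem hx hy
  | neg x _ hx => rw [map_neg]; exact neg_mem hx

end Conjugation

/-! ### `T_p f = a_p(f) f` for newforms -/

section HeckeEigenvalue

variable {N : ℕ} [NeZero N] {k : ℤ}

/-- **Discharge of `IsNewform0.heckeEigenvalue_eq_coeff`**: for a newform `f ∈ S_k(Γ₀(N))`
(a normalised eigenform of all `T_p`), the `T_p`-eigenvalue is the `p`-th Fourier coefficient,
`T_p f = a_p(f) f`, for every prime `p` (Atkin–Lehner 1970, Thm. 3; Diamond–Shurman Prop. 5.8.5: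
compare the coefficients of `q¹` in `T_p f = λ f`, using `a_1(T_p f) = a_p(f)`
(`qExpansion_coeff_heckeT`, Diamond–Shurman Prop. 5.2.2(a)/5.3.1, proved in
`HeckeOperatorsProofs`) and `a_1(f) = 1`). [cite: AtkinLehner1970, Thm. 3] -/
theorem IsNewform0.heckeEigenvalue_eq_coeff_holds :
    IsNewform0.heckeEigenvalue_eq_coeff (N := N) (k := k) := by
  intro f hf p hp
  haveI : NeZero p := ⟨hp.ne_zero⟩
  have heig := heckeT_eq_heckeEigenvalue_smul f p (hf.2.1 p hp)
  have h1 := qExpansion_coeff_heckeT_holds N k f p hp 1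
  have hcoe : ⇑(heckeT (Gamma0 N) k p f) = heckeEigenvalue f p • ⇑f := by
    rw [heig]; rfl
  have hnorm : (qExpansion 1 ⇑f).coeff 1 = 1 := hf.2.2
  rw [hcoe, ModularForm.qExpansion_smul one_pos (one_mem_strictPeriods_gamma0 N) _ f, map_smul,
    smul_eq_mul, hnorm, mul_one, mul_one, if_neg (Nat.Prime.not_dvd_one hp), mul_zero,
    ite_self, add_zero] at h1
  exact h1

end HeckeEigenvalue

/-! ### The Hecke relation for modular symbols (Mazur–Tate–Teitelbaum (4.2)) -/

section HeckeRelation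

variable {N : ℕ} (f : CuspForm (Gamma0 N) 2) (p : ℕ) [NeZero p]

/-- Along the ray above `r`, `βⱼ = (1 j; 0 p)` maps `r + it` to `(r + j)/p + i t/p`. [folklore] -/
theorem tpB_smul_ofComplex (j : ℤ) (r : ℝ) {t : ℝ} (ht : 0 < t) :
    tpB p j • ofComplex ((r : ℂ) + t * Complex.I) =
      ofComplex ((((r + j) / p : ℝ) : ℂ) + ((t / p : ℝ) : ℂ) * Complex.I) := by
  have hp : (0 : ℝ) < p := by exact_mod_cast NeZero.pos p
  have h1 : 0 < ((r : ℂ) + t * Complex.I).im := by simpa using ht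
  have h2 : 0 < ((((r + j) / p : ℝ) : ℂ) + ((t / p : ℝ) : ℂ) * Complex.I).im := by
    simpa using div_pos ht hp
  ext1
  rw [coe_tpB_smul, ofComplex_apply_of_im_pos h1, ofComplex_apply_of_im_pos h2]
  push_cast
  field_simp
  ring

/-- Along the ray above `r`, `diag(p, 1)` maps `r + it` to `p r + i p t`. [folklore] -/
theorem tpD_smul_ofComplex (r : ℝ) {t : ℝ} (ht : 0 < t) :
    tpD p • ofComplex ((r : ℂ) + t * Complex.I) =
      ofComplex ((((p * r : ℝ)) : ℂ) + ((p * t : ℝ) : ℂ) * Complex.I) := by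
  have hp : (0 : ℝ) < p := by exact_mod_cast NeZero.pos p
  have h1 : 0 < ((r : ℂ) + t * Complex.I).im := by simpa using ht
  have h2 : 0 < ((((p * r : ℝ)) : ℂ) + ((p * t : ℝ) : ℂ) * Complex.I).im := by
    simpa using mul_pos hp ht
  ext1
  rw [coe_tpD_smul, ofComplex_apply_of_im_pos h1, ofComplex_apply_of_im_pos h2]
  push_cast
  ring

/-- **The ray integral of `f ∣[2] βⱼ`**:
`∫₀^∞ (f ∣[2] (1 j; 0 p))(r + it) dt = ∫₀^∞ f((r + j)/p + it) dt`
(`(f ∣[2] βⱼ)(τ) = p⁻¹ f((τ + j)/p)` and the substitution `t ↦ t/p`) (Mazur–Tate–Teitelbaum 1986,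
§I.4; Cremona §2.9). [folklore] -/
theorem integral_slash_tpB_ray (j : ℤ) (r : ℝ) :
    ∫ t in Ioi (0 : ℝ), (⇑f ∣[(2 : ℤ)] tpB p j) (ofComplex ((r : ℂ) + t * Complex.I)) =
      ∫ t in Ioi (0 : ℝ), f (ofComplex ((((r + j) / p : ℝ) : ℂ) + t * Complex.I)) := by
  have hp : (0 : ℝ) < p := by exact_mod_cast NeZero.pos p
  have hstep : ∫ t in Ioi (0 : ℝ), (⇑f ∣[(2 : ℤ)] tpB p j) (ofComplex ((r : ℂ) + t * Complex.I)) =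
      ∫ t in Ioi (0 : ℝ), (p : ℂ)⁻¹ *
        (fun s : ℝ ↦ f (ofComplex ((((r + j) / p : ℝ) : ℂ) + s * Complex.I))) ((p : ℝ)⁻¹ * t) := by
    refine setIntegral_congr_fun measurableSet_Ioi fun t ht ↦ ?_
    dsimp only
    rw [slash_tpB_apply, tpB_smul_ofComplex p j r ht, div_eq_inv_mul t]
  rw [hstep, integral_const_mul, integral_comp_mul_left_Ioi
    (fun s : ℝ ↦ f (ofComplex ((((r + j) / p : ℝ) : ℂ) + s * Complex.I))) 0 (inv_pos.mpr hp),
    mul_zero,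
    inv_inv, Complex.real_smul, ← mul_assoc, ofReal_natCast,
    inv_mul_cancel₀ (by exact_mod_cast NeZero.ne p : (p : ℂ) ≠ 0), one_mul]

/-- **The ray integral of `f ∣[2] diag(p, 1)`**:
`∫₀^∞ (f ∣[2] diag(p,1))(r + it) dt = ∫₀^∞ f(pr + it) dt`
(`(f ∣[2] diag(p,1))(τ) = p f(pτ)` and the substitution `t ↦ pt`). [folklore] -/
theorem integral_slash_tpD_ray (r : ℝ) :
    ∫ t in Ioi (0 : ℝ), (⇑f ∣[(2 : ℤ)] tpD p) (ofComplex ((r : ℂ) + t * Complex.I)) =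
      ∫ t in Ioi (0 : ℝ), f (ofComplex ((((p * r : ℝ)) : ℂ) + t * Complex.I)) := by
  have hp : (0 : ℝ) < p := by exact_mod_cast NeZero.pos p
  have hstep : ∫ t in Ioi (0 : ℝ), (⇑f ∣[(2 : ℤ)] tpD p) (ofComplex ((r : ℂ) + t * Complex.I)) =
      ∫ t in Ioi (0 : ℝ), (p : ℂ) *
        (fun s : ℝ ↦ f (ofComplex ((((p * r : ℝ)) : ℂ) + s * Complex.I))) ((p : ℝ) * t) := by
    refine setIntegral_congr_fun measurableSet_Ioi fun t ht ↦ ?_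
    dsimp only
    rw [slash_tpD_apply, tpD_smul_ofComplex p r ht]
    norm_num
  rw [hstep, integral_const_mul, integral_comp_mul_left_Ioi
    (fun s : ℝ ↦ f (ofComplex ((((p * r : ℝ)) : ℂ) + s * Complex.I))) 0 hp, mul_zero,
    Complex.real_smul, ← mul_assoc, ofReal_inv, ofReal_natCast,
    mul_inv_cancel₀ (by exact_mod_cast NeZero.ne p : (p : ℂ) ≠ 0), one_mul]

variable [NeZero N]

/-- **The Hecke operator on modular symbols** (Mazur–Tate–Teitelbaum 1986, §I.4, (4.2);
Cremona §2.9): for `p` prime, `p ∤ N`, and `f ∈ S₂(Γ₀(N))`,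
`{∞, r}_{T_p f} = ∑_{j mod p} {∞, (r + j)/p}_f + {∞, p r}_f`, from Diamond–Shurman Prop. 5.2.1
(`T_p f = ∑ⱼ f ∣[2] (1 j; 0 p) + f ∣[2] diag(p, 1)`, `coe_heckeT_gamma0_eq_sum`) and the ray
integrals `integral_slash_tpB_ray`, `integral_slash_tpD_ray`. [folklore] -/
theorem modularSymbol_heckeT (hp : p.Prime) (hpN : ¬ p ∣ N) (r : ℚ) :
    modularSymbol (heckeT (Gamma0 N) 2 p f) r =
      ∑ j : Fin p, modularSymbol f ((r + j) / p) + modularSymbol f (p * r) := by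
  have hp0 : (0 : ℝ) < p := by exact_mod_cast hp.pos
  have hcoe := coe_heckeT_gamma0_eq_sum N 2 p hp f
  rw [if_neg hpN] at hcoe
  -- the rays of the slashed forms, as rescaled rays of `f`
  have hrayB : ∀ (j : Fin p) (t : ℝ), t ∈ Ioi (0 : ℝ) →
      (⇑f ∣[(2 : ℤ)] tpB p ((j : ℕ) : ℤ)) (ofComplex ((r : ℂ) + t * Complex.I)) =
        (p : ℂ)⁻¹ * (fun s : ℝ ↦ f (ofComplex (((((r + j) / p : ℚ)) : ℂ) + s * Complex.I)))
          ((p : ℝ)⁻¹ * t) := by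
    intro j t ht
    dsimp only
    rw [slash_tpB_apply, ← Complex.ofReal_ratCast, tpB_smul_ofComplex p _ _ ht,
      div_eq_inv_mul t]
    congr 4
    push_cast
    ring
  have hrayD : ∀ t : ℝ, t ∈ Ioi (0 : ℝ) →
      (⇑f ∣[(2 : ℤ)] tpD p) (ofComplex ((r : ℂ) + t * Complex.I)) =
        (p : ℂ) * (fun s : ℝ ↦ f (ofComplex ((((p * r : ℚ)) : ℂ) + s * Complex.I)))
          ((p : ℝ) * t) := by
    intro t ht
    dsimp only
    rw [slash_tpD_apply, ← Complex.ofReal_ratCast, tpD_smul_ofComplex p _ ht]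
    norm_num
  -- integrability of the slashed rays
  have hintB : ∀ j : Fin p, IntegrableOn
      (fun t : ℝ ↦ (⇑f ∣[(2 : ℤ)] tpB p ((j : ℕ) : ℤ)) (ofComplex ((r : ℂ) + t * Complex.I)))
      (Ioi 0) := by
    intro j
    have hq := integrableOn_modularSymbol_integrand_holds f ((r + j) / p)
    have h2 : IntegrableOn (fun t : ℝ ↦ (p : ℂ)⁻¹ *
        (fun s : ℝ ↦ f (ofComplex (((((r + j) / p : ℚ)) : ℂ) + s * Complex.I))) ((p : ℝ)⁻¹ * t))
        (Ioi 0) := by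
      refine Integrable.const_mul ?_ _
      have h := (integrableOn_Ioi_comp_mul_left_iff
        (fun s : ℝ ↦ f (ofComplex (((((r + j) / p : ℚ)) : ℂ) + s * Complex.I))) 0
        (inv_pos.mpr hp0)).mpr (by rw [mul_zero]; exact hq)
      exact h
    exact h2.congr_fun (fun t ht ↦ (hrayB j t ht).symm) measurableSet_Ioi
  have hintD : IntegrableOn
      (fun t : ℝ ↦ (⇑f ∣[(2 : ℤ)] tpD p) (ofComplex ((r : ℂ) + t * Complex.I))) (Ioi 0) := by
    have hq := integrableOn_modularSymbol_integrand_holds f (p * r)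
    have h2 : IntegrableOn (fun t : ℝ ↦ (p : ℂ) *
        (fun s : ℝ ↦ f (ofComplex ((((p * r : ℚ)) : ℂ) + s * Complex.I))) ((p : ℝ) * t))
        (Ioi 0) := by
      refine Integrable.const_mul ?_ _
      exact (integrableOn_Ioi_comp_mul_left_iff
        (fun s : ℝ ↦ f (ofComplex ((((p * r : ℚ)) : ℂ) + s * Complex.I))) 0 hp0).mpr
        (by rw [mul_zero]; exact hq)
    exact h2.congr_fun (fun t ht ↦ (hrayD t ht).symm) measurableSet_Ioi
  -- the integrand of `{∞, r}_{T_p f}`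
  have hfun : ∀ t : ℝ, (heckeT (Gamma0 N) 2 p f) (ofComplex ((r : ℂ) + t * Complex.I)) =
      ∑ j : Fin p, (⇑f ∣[(2 : ℤ)] tpB p ((j : ℕ) : ℤ)) (ofComplex ((r : ℂ) + t * Complex.I)) +
        (⇑f ∣[(2 : ℤ)] tpD p) (ofComplex ((r : ℂ) + t * Complex.I)) := by
    intro t
    have h := congr_fun hcoe (ofComplex ((r : ℂ) + t * Complex.I))
    rw [h, Pi.add_apply, Finset.sum_apply]
  -- integrate
  have hIB : ∀ j : Fin p, ∫ t in Ioi (0 : ℝ),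
      (⇑f ∣[(2 : ℤ)] tpB p ((j : ℕ) : ℤ)) (ofComplex ((r : ℂ) + t * Complex.I)) =
        ∫ t in Ioi (0 : ℝ), f (ofComplex (((((r + j) / p : ℚ)) : ℂ) + t * Complex.I)) := by
    intro j
    rw [setIntegral_congr_fun measurableSet_Ioi (hrayB j), integral_const_mul,
      integral_comp_mul_left_Ioi
        (fun s : ℝ ↦ f (ofComplex (((((r + j) / p : ℚ)) : ℂ) + s * Complex.I))) 0
        (inv_pos.mpr hp0), mul_zero, inv_inv, Complex.real_smul, ← mul_assoc, ofReal_natCast,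
      inv_mul_cancel₀ (by exact_mod_cast hp.ne_zero : (p : ℂ) ≠ 0), one_mul]
  have hID : ∫ t in Ioi (0 : ℝ), (⇑f ∣[(2 : ℤ)] tpD p) (ofComplex ((r : ℂ) + t * Complex.I)) =
      ∫ t in Ioi (0 : ℝ), f (ofComplex ((((p * r : ℚ)) : ℂ) + t * Complex.I)) := by
    rw [setIntegral_congr_fun measurableSet_Ioi hrayD, integral_const_mul,
      integral_comp_mul_left_Ioi
        (fun s : ℝ ↦ f (ofComplex ((((p * r : ℚ)) : ℂ) + s * Complex.I))) 0 hp0, mul_zero,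
      Complex.real_smul, ← mul_assoc, ofReal_inv, ofReal_natCast,
      mul_inv_cancel₀ (by exact_mod_cast hp.ne_zero : (p : ℂ) ≠ 0), one_mul]
  simp only [modularSymbol]
  rw [show (fun t : ℝ ↦ (heckeT (Gamma0 N) 2 p f) (ofComplex ((r : ℂ) + t * Complex.I))) =
      fun t : ℝ ↦ ∑ j : Fin p, (⇑f ∣[(2 : ℤ)] tpB p ((j : ℕ) : ℤ))
        (ofComplex ((r : ℂ) + t * Complex.I)) +
        (⇑f ∣[(2 : ℤ)] tpD p) (ofComplex ((r : ℂ) + t * Complex.I)) from funext hfun,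
    integral_add (integrable_finsetSum _ fun j _ ↦ hintB j) hintD,
    integral_finsetSum _ fun j _ ↦ hintB j, hID, mul_add, Finset.mul_sum]
  congr 1
  refine Finset.sum_congr rfl fun j _ ↦ ?_
  rw [hIB j]

omit [NeZero N] in
/-- `{∞, r}_{c • f} = c {∞, r}_f`. [folklore] -/
theorem modularSymbol_smul (c : ℂ) (r : ℚ) : modularSymbol (c • f) r = c * modularSymbol f r := by
  have h : ∀ z : ℍ, (c • f) z = c * f z := fun z ↦ rfl
  simp only [modularSymbol, h]
  rw [integral_const_mul]
  ring

/-- **The Hecke relation for the modular symbols of a newform** (Mazur–Tate–Teitelbaum 1986,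
§I.4, (4.2): "`a_p [r] = ∑_{u mod p} [(r + u)/p] + [p r]`" for `p ∤ N`; Cremona §2.9): for a
newform `f ∈ S₂(Γ₀(N))` and a prime `p ∤ N`,
`a_p(f) {∞, r}_f = ∑_{j mod p} {∞, (r + j)/p}_f + {∞, p r}_f`, since `T_p f = a_p(f) f`
(`f` is a Hecke eigenform and `heckeEigenvalue f p = a_p(f)`,
`IsNewform0.heckeEigenvalue_eq_coeff_holds`) and `modularSymbol_heckeT`.
[cite: MazurTateTeitelbaum1986Invent, §I.4 (4.2)] -/
theorem cuspCoeff_mul_modularSymbol {f : CuspForm (Gamma0 N) 2} (hf : IsNewform0 f) (hp : p.Prime)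
    (hpN : ¬ p ∣ N) (r : ℚ) :
    cuspCoeff f p * modularSymbol f r =
      ∑ j : Fin p, modularSymbol f ((r + j) / p) + modularSymbol f (p * r) := by
  have heig : heckeT (Gamma0 N) 2 p f = cuspCoeff f p • f := by
    rw [heckeT_eq_heckeEigenvalue_smul f p (hf.2.1 p hp),
      IsNewform0.heckeEigenvalue_eq_coeff_holds hf hp]
    rfl
  rw [← modularSymbol_heckeT f p hp hpN r, heig, modularSymbol_smul]

end HeckeRelation

/-! ### From `{∞, ·}` to the rational plus symbol `[·]⁺` -/

section PlusSymbol

variable {N : ℕ} [NeZero N] (f : CuspForm (Gamma0 N) 2) (p : ℕ) [NeZero p]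

omit [NeZero N] in
/-- **Reflecting a `1`-periodic sum over the residues mod `p`**: if `h(x + 1) = h(x)` then
`∑_{j < p} h((x - j)/p) = ∑_{j < p} h((x + j)/p)` (both are the sum of `h` over the `p`
preimages of `x` under multiplication by `p` on `ℚ/ℤ`). [folklore] -/
theorem sum_fin_reflect_of_periodic {M : Type*} [AddCommGroup M] (h : ℚ → M)
    (hper : ∀ x : ℚ, h (x + 1) = h x) (x : ℚ) :
    ∑ j : Fin p, h ((x - j) / p) = ∑ j : Fin p, h ((x + j) / p) := by
  have hp : (p : ℚ) ≠ 0 := by exact_mod_cast NeZero.ne p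
  have hper' : ∀ (x : ℚ) (n : ℕ), h (x + n) = h x := by
    intro x n
    induction n with
    | zero => simp
    | succ n ih => rw [Nat.cast_succ, ← add_assoc, hper, ih]
  -- `∑_{j<p} h((x - j)/p) = ∑_{j<p} h((x - (p-1) + j)/p)` by reflection `j ↦ p - 1 - j`
  rw [Fin.sum_univ_eq_sum_range (fun j ↦ h ((x - j) / p)),
    Fin.sum_univ_eq_sum_range (fun j ↦ h ((x + j) / p))]
  have h1 : ∑ j ∈ Finset.range p, h ((x - j) / p) =
      ∑ j ∈ Finset.range p, h ((x - (p - 1 : ℕ) + j) / p) := by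
    rw [← Finset.sum_range_reflect (fun j ↦ h ((x - (p - 1 : ℕ) + j) / p)) p]
    refine Finset.sum_congr rfl fun j hj ↦ ?_
    rw [Finset.mem_range] at hj
    congr 2
    rw [Nat.cast_sub (show j ≤ p - 1 by omega)]
    ring
  -- shift by one: `(x - (p-1) + j)/p = (x + 1 + j)/p - 1`
  have h2 : ∀ j : ℕ, h ((x - (p - 1 : ℕ) + j) / p) = h ((x + (j + 1 : ℕ)) / p) := by
    intro j
    have : (x + ((j + 1 : ℕ) : ℚ)) / p = (x - (p - 1 : ℕ) + j) / p + 1 := by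
      rw [Nat.cast_sub (NeZero.one_le (n := p))]
      push_cast
      field_simp
      ring
    rw [this, hper]
  rw [h1, Finset.sum_congr rfl fun j _ ↦ h2 j]
  -- `∑_{j<p} u(j+1) = ∑_{j<p} u(j)` for `u(j) = h((x + j)/p)`, as `u(p) = u(0)`
  have h3 := Finset.sum_range_succ' (fun i : ℕ ↦ h ((x + i) / p)) p
  have h4 := Finset.sum_range_succ (fun i : ℕ ↦ h ((x + i) / p)) p
  have hp0 : h ((x + (p : ℕ)) / p) = h ((x + (0 : ℕ)) / p) := by
    rw [Nat.cast_zero, add_zero, show (x + (p : ℕ)) / (p : ℚ) = x / p + 1 by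
      field_simp, hper]
  rw [h4, hp0] at h3
  -- h3 : ∑_{i<p} u i + u 0 = ∑_{j<p} u (j+1) + u 0
  exact (add_right_cancel h3).symm

/-- **The Hecke relation for the plus symbols**:
`a_p plusSymbol(r) = ∑_{j mod p} plusSymbol((r + j)/p) + plusSymbol(p r)` for `p ∤ N`
(from `cuspCoeff_mul_modularSymbol` at `r` and `-r`, using `{∞, x + 1} = {∞, x}` to reflect the
sum at `-r`). [folklore] -/
theorem cuspCoeff_mul_plusSymbol {f : CuspForm (Gamma0 N) 2} (hf : IsNewform0 f) (hp : p.Prime)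
    (hpN : ¬ p ∣ N) (r : ℚ) :
    cuspCoeff f p * plusSymbol f r =
      ∑ j : Fin p, plusSymbol f ((r + j) / p) + plusSymbol f (p * r) := by
  have h1 := cuspCoeff_mul_modularSymbol p hf hp hpN r
  have h2 := cuspCoeff_mul_modularSymbol p hf hp hpN (-r)
  have hrefl : ∑ j : Fin p, modularSymbol f ((-r + j) / p) =
      ∑ j : Fin p, modularSymbol f (-((r + j) / p)) := by
    rw [← sum_fin_reflect_of_periodic p (modularSymbol f) (fun x ↦ by
      exact_mod_cast modularSymbol_add_intCast_holds f x 1) (-r)]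
    refine Finset.sum_congr rfl fun j _ ↦ ?_
    congr 1
    ring
  rw [hrefl] at h2
  have hsum : ∑ j : Fin p, plusSymbol f ((r + j) / p) =
      (∑ j : Fin p, modularSymbol f ((r + j) / p) +
        ∑ j : Fin p, modularSymbol f (-((r + j) / p))) / 2 := by
    simp only [plusSymbol]
    rw [← Finset.sum_add_distrib, Finset.sum_div]
  have hneg : modularSymbol f ((p : ℚ) * -r) = modularSymbol f (-((p : ℚ) * r)) := by
    rw [mul_neg]
  rw [hsum, plusSymbol, plusSymbol, mul_div_assoc', mul_add, h1, h2, hneg]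
  ring

/-- **The Hecke relation for the normalised plus symbols** `[r] = re plusSymbol(r) / Ω⁺`:
`a_p [r] = ∑_{j mod p} [(r + j)/p] + [p r]` for `p ∤ N` and `a_p(f) = a_p ∈ ℤ`
(Mazur–Tate–Teitelbaum 1986, §I.4 (4.2) with §I.8). [folklore] -/
theorem intCast_mul_normalizedPlusSymbol {f : CuspForm (Gamma0 N) 2} (hf : IsNewform0 f)
    (hp : p.Prime) (hpN : ¬ p ∣ N) {ap : ℤ}
    (hap : cuspCoeff f p = ap) (r : ℚ) :
    (ap : ℝ) * normalizedPlusSymbol f r =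
      ∑ j : Fin p, normalizedPlusSymbol f ((r + j) / p) + normalizedPlusSymbol f (p * r) := by
  have h := cuspCoeff_mul_plusSymbol p hf hp hpN r
  rw [hap] at h
  have hre := congr_arg Complex.re h
  rw [show ((ap : ℤ) : ℂ) = ((ap : ℝ) : ℂ) by norm_cast, Complex.re_ofReal_mul, Complex.add_re,
    Complex.re_sum] at hre
  simp only [normalizedPlusSymbol]
  rw [mul_div_assoc', hre, add_div, Finset.sum_div]

/-- **The Hecke relation for the rational plus symbols** `[r]⁺ = ratPlusSymbol f r`:
`a_p [r]⁺ = ∑_{j mod p} [(r + j)/p]⁺ + [p r]⁺` in `ℚ` for a rational newform and `p ∤ N`, given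
the rationality `([r]⁺ : ℝ) = [r]` (`ratCast_ratPlusSymbol`, Manin–Drinfeld; hypothesis `hrat`)
(Mazur–Tate–Teitelbaum 1986, §I.4 (4.2), §I.8, §I.10). [folklore] -/
theorem intCast_mul_ratPlusSymbol {f : CuspForm (Gamma0 N) 2} (hf : IsNewform0 f) (hp : p.Prime)
    (hpN : ¬ p ∣ N) {ap : ℤ}
    (hap : cuspCoeff f p = ap) (hrat : ∀ r : ℚ, (ratPlusSymbol f r : ℝ) = normalizedPlusSymbol f r)
    (r : ℚ) :
    (ap : ℚ) * ratPlusSymbol f r =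
      ∑ j : Fin p, ratPlusSymbol f ((r + j) / p) + ratPlusSymbol f (p * r) := by
  apply Rat.cast_injective (α := ℝ)
  push_cast
  simp only [hrat]
  exact intCast_mul_normalizedPlusSymbol p hf hp hpN hap r

end PlusSymbol

/-! ### Uniform Manin–Drinfeld denominators -/

section UniformDenominators

variable {N : ℕ} [NeZero N] (f : CuspForm (Gamma0 N) 2)

omit [NeZero N] in
/-- Every rational number is `g∞ = a/c` for some `g = (a b; c d) ∈ SL(2, ℤ)` (Bézout). [folklore] -/
theorem exists_SL2Z_apply_infty_eq (r : ℚ) :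
    ∃ g : SL(2, ℤ), (g 1 0 : ℤ) ≠ 0 ∧ ((g 0 0 : ℤ) : ℚ) / ((g 1 0 : ℤ) : ℚ) = r := by
  have hcop : IsCoprime r.num (r.den : ℤ) := by
    rw [Int.isCoprime_iff_gcd_eq_one, Int.gcd, Int.natAbs_natCast]
    exact r.reduced
  obtain ⟨x, y, hxy⟩ := hcop
  refine ⟨⟨!![r.num, -y; (r.den : ℤ), x], by rw [Matrix.det_fin_two_of]; linear_combination hxy⟩,
    ?_, ?_⟩
  · change (r.den : ℤ) ≠ 0
    exact_mod_cast r.den_ne_zero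
  · change ((r.num : ℤ) : ℚ) / ((r.den : ℤ) : ℚ) = r
    push_cast
    exact Rat.num_div_den r

/-- **Finitely many right cosets**: there is a finite set `S ⊆ SL(2, ℤ)` with
`SL(2, ℤ) = ⋃_{m ∈ S} Γ₀(N) m` (`Γ₀(N)` has finite index, Mathlib
`CongruenceSubgroup.instFiniteIndexGamma0`). [folklore] -/
theorem exists_finset_gamma0_mul :
    ∃ S : Finset SL(2, ℤ), ∀ g : SL(2, ℤ), ∃ m ∈ S, g * m⁻¹ ∈ Gamma0 N := by
  classical
  haveI : Finite (SL(2, ℤ) ⧸ Gamma0 N) := Subgroup.finite_quotient_of_finiteIndex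
  haveI : Fintype (SL(2, ℤ) ⧸ Gamma0 N) := Fintype.ofFinite _
  refine ⟨Finset.univ.image fun q : SL(2, ℤ) ⧸ Gamma0 N ↦ (Quotient.out q)⁻¹, fun g ↦ ?_⟩
  refine ⟨(Quotient.out (QuotientGroup.mk g⁻¹ : SL(2, ℤ) ⧸ Gamma0 N))⁻¹,
    Finset.mem_image_of_mem _ (Finset.mem_univ _), ?_⟩
  have h : (QuotientGroup.mk (Quotient.out (QuotientGroup.mk g⁻¹ : SL(2, ℤ) ⧸ Gamma0 N)) :
      SL(2, ℤ) ⧸ Gamma0 N) = QuotientGroup.mk g⁻¹ := QuotientGroup.out_eq' _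
  rw [QuotientGroup.eq] at h
  -- h : (out)⁻¹ * g⁻¹ ∈ Γ₀(N)
  have := Subgroup.inv_mem _ h
  simpa [mul_inv_rev, inv_inv] using this

/-- **Uniform Manin–Drinfeld denominators**: if every `{∞, r}_f` has a positive multiple in
`Λ_f` (`exists_nsmul_modularSymbol_mem_periodLattice`, Manin–Drinfeld), then one positive
integer `n` works for all `r ∈ ℚ`: writing `r = g∞`, `g = γ m` with `γ ∈ Γ₀(N)` and `m` in a
finite set of coset representatives, Manin's relation gives `{∞, r} = {∞, γ∞} + {∞, m∞}`
(`modularSymbol_gamma0_smul`; `= {∞, γ∞} ∈ Λ_f` if `m∞ = ∞`), so the finitely many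
denominators of the `{∞, m∞}` suffice (Manin 1972, §1.5–1.6, Cor. 3.6; Cremona 1997, §2.2,
§2.8). [cite: Manin1972, Cor. 3.6] -/
theorem exists_forall_nsmul_modularSymbol_mem_periodLattice
    (H : exists_nsmul_modularSymbol_mem_periodLattice f) :
    ∃ n : ℕ, 0 < n ∧ ∀ r : ℚ, n • modularSymbol f r ∈ periodLattice f := by
  classical
  obtain ⟨S, hS⟩ := exists_finset_gamma0_mul (N := N)
  -- the denominator attached to a coset representative `m`
  let d : SL(2, ℤ) → ℕ := fun m ↦
    if (m 1 0 : ℤ) = 0 then 1 else (H (((m 0 0 : ℤ) : ℚ) / ((m 1 0 : ℤ) : ℚ))).choose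
  have hdpos : ∀ m, 0 < d m := fun m ↦ by
    simp only [d]
    split_ifs with h
    · exact one_pos
    · exact (H _).choose_spec.1
  have hdmem : ∀ m, (m 1 0 : ℤ) ≠ 0 →
      d m • modularSymbol f (((m 0 0 : ℤ) : ℚ) / ((m 1 0 : ℤ) : ℚ)) ∈ periodLattice f := fun m h ↦ by
    simp only [d, if_neg h]
    exact (H _).choose_spec.2
  refine ⟨∏ m ∈ S, d m, Finset.prod_pos fun m _ ↦ hdpos m, fun r ↦ ?_⟩
  obtain ⟨g, hg0, hgr⟩ := exists_SL2Z_apply_infty_eq r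
  obtain ⟨m, hmS, hγ⟩ := hS g
  set γ : Gamma0 N := ⟨g * m⁻¹, hγ⟩ with hγdef
  have hgm : g = (γ : SL(2, ℤ)) * m := by simp [hγdef]
  -- entries of `g = γ m`
  have h00 : (g 0 0 : ℤ) = (γ : SL(2, ℤ)) 0 0 * m 0 0 + (γ : SL(2, ℤ)) 0 1 * m 1 0 := by
    rw [hgm, Matrix.SpecialLinearGroup.coe_mul, Matrix.mul_apply, Fin.sum_univ_two]
  have h10 : (g 1 0 : ℤ) = (γ : SL(2, ℤ)) 1 0 * m 0 0 + (γ : SL(2, ℤ)) 1 1 * m 1 0 := by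
    rw [hgm, Matrix.SpecialLinearGroup.coe_mul, Matrix.mul_apply, Fin.sum_univ_two]
  obtain ⟨k, hk⟩ : d m ∣ ∏ m ∈ S, d m := Finset.dvd_prod_of_mem d hmS
  rw [hk, mul_nsmul]
  refine (periodLattice f).nsmul_mem ?_ k
  by_cases hm : (m 1 0 : ℤ) = 0
  · -- `m∞ = ∞`: `r = γ∞` and `{∞, r} = {∞, γ∞} ∈ Λ_f`
    rw [hm, mul_zero, add_zero] at h00 h10
    have hγ10 : ((γ : SL(2, ℤ)) 1 0 : ℤ) ≠ 0 := fun h ↦ hg0 (by rw [h10, h, zero_mul])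
    have hm00 : (m 0 0 : ℤ) ≠ 0 := fun h ↦ hg0 (by rw [h10, h, mul_zero])
    have hr : r = (((γ : SL(2, ℤ)) 0 0 : ℤ) : ℚ) / (((γ : SL(2, ℤ)) 1 0 : ℤ) : ℚ) := by
      rw [← hgr, h00, h10]
      push_cast
      rw [mul_div_mul_right _ _ (by exact_mod_cast hm00)]
    have hcusp : cuspSymbol f γ = modularSymbol f r := by
      rw [cuspSymbol, if_neg hγ10, hr]
    rw [← hcusp]
    exact (periodLattice f).nsmul_mem (cuspSymbol_mem_periodLattice f γ) _
  · -- `m∞ = s ∈ ℚ`: `{∞, r} = {∞, γ s} = {∞, γ∞} + {∞, s}`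
    set s : ℚ := ((m 0 0 : ℤ) : ℚ) / ((m 1 0 : ℤ) : ℚ) with hs
    have hm0 : ((m 1 0 : ℤ) : ℚ) ≠ 0 := by exact_mod_cast hm
    have hden : (((γ : SL(2, ℤ)) 1 0 : ℤ) : ℚ) * s + (((γ : SL(2, ℤ)) 1 1 : ℤ) : ℚ) =
        ((g 1 0 : ℤ) : ℚ) / ((m 1 0 : ℤ) : ℚ) := by
      rw [h10, hs]
      push_cast
      field_simp
    have hnum : (((γ : SL(2, ℤ)) 0 0 : ℤ) : ℚ) * s + (((γ : SL(2, ℤ)) 0 1 : ℤ) : ℚ) =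
        ((g 0 0 : ℤ) : ℚ) / ((m 1 0 : ℤ) : ℚ) := by
      rw [h00, hs]
      push_cast
      field_simp
    have hne : (((γ : SL(2, ℤ)) 1 0 : ℤ) : ℚ) * s + (((γ : SL(2, ℤ)) 1 1 : ℤ) : ℚ) ≠ 0 := by
      rw [hden]
      exact div_ne_zero (by exact_mod_cast hg0) hm0
    have hManin := modularSymbol_gamma0_smul_holds f γ s hne
    rw [hnum, hden, div_div_div_cancel_right₀ hm0, hgr] at hManin
    rw [hManin, nsmul_add]
    exact add_mem ((periodLattice f).nsmul_mem (cuspSymbol_mem_periodLattice f γ) _) (hdmem m hm)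

end UniformDenominators

/-! ### Rationality and bounded denominators of `[r]⁺` for rational newforms -/

section Rationality

variable {N : ℕ} [NeZero N] {f : CuspForm (Gamma0 N) 2}

/-- For a rational newform, `Ω⁺_f > 0` and `re Λ_f = ℤ · Ω⁺_f/2`, given Eichler–Shimura
(`isZLattice_periodLattice`): `Λ_f` is a conjugation-stable lattice
(`conj_mem_periodLattice_holds`, `exists_pos_map_re_eq_zmultiples`; Cremona 1997, §2.8).
[cite: CremonaAlgorithms1997, §2.8] -/
theorem plusPeriod_pos_and_realPeriods_eq (hES : isZLattice_periodLattice (f := f))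
    (hf : IsNewform0 f) (hQ : coeffField f = ⊥) :
    0 < plusPeriod f ∧ realPeriods f = AddSubgroup.zmultiples (plusPeriod f / 2) := by
  obtain ⟨_, hlat⟩ := hES hf hQ
  have h : ∃ Ω : ℝ, 0 < Ω ∧ realPeriods f = AddSubgroup.zmultiples (Ω / 2) :=
    exists_pos_map_re_eq_zmultiples hlat (fun _ hz ↦ conj_mem_periodLattice_holds hf hQ hz)
  have hΩ : plusPeriod f = h.choose := by simp only [plusPeriod, dif_pos h]
  rw [hΩ]
  exact h.choose_spec

/-- **Bounded denominators of `[r] = re plusSymbol(r)/Ω⁺`**: for a rational newform there is one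
`D > 0` with `[r]_f ∈ (1/D)ℤ` for all `r ∈ ℚ` (`D = 4n`, `n` the uniform Manin–Drinfeld
denominator: `re (n{∞, ±r}) ∈ re Λ_f = ℤ Ω⁺/2`), given Eichler–Shimura and Manin–Drinfeld
(Manin 1972, Cor. 3.6; Mazur–Tate–Teitelbaum 1986, §I.8; Cremona 1997, §2.8).
[cite: Manin1972, Cor. 3.6] -/
theorem exists_forall_normalizedPlusSymbol_eq_div (hES : isZLattice_periodLattice (f := f))
    (hMD : exists_nsmul_modularSymbol_mem_periodLattice f) (hf : IsNewform0 f)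
    (hQ : coeffField f = ⊥) :
    ∃ D : ℕ, 0 < D ∧ ∀ r : ℚ, ∃ m : ℤ, normalizedPlusSymbol f r = (m : ℝ) / D := by
  obtain ⟨hpos, hre⟩ := plusPeriod_pos_and_realPeriods_eq hES hf hQ
  obtain ⟨n, hn, hmem⟩ := exists_forall_nsmul_modularSymbol_mem_periodLattice f hMD
  refine ⟨4 * n, by omega, fun r ↦ ?_⟩
  have h1 : (n • modularSymbol f r).re ∈ realPeriods f := AddSubgroup.mem_map_of_mem _ (hmem r)
  have h2 : (n • modularSymbol f (-r)).re ∈ realPeriods f :=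
    AddSubgroup.mem_map_of_mem _ (hmem (-r))
  rw [hre, AddSubgroup.mem_zmultiples_iff] at h1 h2
  obtain ⟨k₁, hk₁⟩ := h1
  obtain ⟨k₂, hk₂⟩ := h2
  refine ⟨k₁ + k₂, ?_⟩
  rw [Complex.re_nsmul, nsmul_eq_mul, zsmul_eq_mul] at hk₁ hk₂
  have hn' : (n : ℝ) ≠ 0 := by exact_mod_cast hn.ne'
  have hplus : (plusSymbol f r).re = ((modularSymbol f r).re + (modularSymbol f (-r)).re) / 2 := by
    rw [plusSymbol, Complex.div_ofNat_re, Complex.add_re]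
  have hΩ0 : plusPeriod f ≠ 0 := hpos.ne'
  rw [normalizedPlusSymbol, hplus]
  push_cast
  field_simp
  linarith [hk₁, hk₂]

/-- **Bounded denominators of the rational plus symbols `[r]⁺ = ratPlusSymbol f r`**: for a
rational newform there is one `D > 0` with `ratPlusSymbol f r ∈ (1/D)ℤ` for all `r`, given
Eichler–Shimura and Manin–Drinfeld (Manin 1972, Cor. 3.6; Mazur–Tate–Teitelbaum 1986, §I.8: the
`[r]⁺` "have bounded denominators"). [cite: Manin1972, Cor. 3.6] -/
theorem exists_forall_ratPlusSymbol_eq_div (hES : isZLattice_periodLattice (f := f))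
    (hMD : exists_nsmul_modularSymbol_mem_periodLattice f) (hf : IsNewform0 f)
    (hQ : coeffField f = ⊥) :
    ∃ D : ℕ, 0 < D ∧ ∀ r : ℚ, ∃ m : ℤ, ratPlusSymbol f r = (m : ℚ) / D := by
  obtain ⟨D, hD, h⟩ := exists_forall_normalizedPlusSymbol_eq_div hES hMD hf hQ
  refine ⟨D, hD, fun r ↦ ?_⟩
  obtain ⟨m, hm⟩ := h r
  refine ⟨m, ?_⟩
  have hex : ∃ q : ℚ, (q : ℝ) = normalizedPlusSymbol f r := ⟨m / D, by rw [hm]; push_cast; rfl⟩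
  rw [ratPlusSymbol, dif_pos hex]
  apply Rat.cast_injective (α := ℝ)
  rw [hex.choose_spec, hm]
  push_cast
  rfl

/-- **`([r]⁺ : ℝ) = [r]` for a rational newform** (the statement of the named fact
`ratCast_ratPlusSymbol` for `f`), given Eichler–Shimura and Manin–Drinfeld: `[r] ∈ ℚ` by
`IsNewform0.exists_rat_smul_plusPeriod_of` (`ModularSymbolsHeckeProofs`) fed with
`conj_mem_periodLattice_holds` (Mazur–Tate–Teitelbaum 1986, §I.8).
[cite: MazurTateTeitelbaum1986Invent, §I.8] -/
theorem ratCast_ratPlusSymbol_of_lattice (hES : isZLattice_periodLattice (f := f))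
    (hMD : exists_nsmul_modularSymbol_mem_periodLattice f) (hf : IsNewform0 f)
    (hQ : coeffField f = ⊥) (r : ℚ) :
    (ratPlusSymbol f r : ℝ) = normalizedPlusSymbol f r := by
  obtain ⟨q, hq⟩ := IsNewform0.exists_normalizedPlusSymbol_eq_ratCast_of
    (IsNewform0.exists_rat_smul_plusPeriod_of hES conj_mem_periodLattice_holds hMD) hf hQ r
  have hex : ∃ q : ℚ, (q : ℝ) = normalizedPlusSymbol f r := ⟨q, hq.symm⟩
  rw [ratPlusSymbol, dif_pos hex]
  exact hex.choose_spec

end Rationality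

end Literature.NumberTheory.EllipticCurves.ModularForms

namespace Literature.NumberTheory.EllipticCurves

/-! ### Boundedness of `μ_{f,α}` for the unit root -/

section Boundedness

variable {N : ℕ} [NeZero N] {f : CuspForm (Gamma0 N) 2} {p : ℕ} [Fact p.Prime]

/-- **`μ_{f,α}` is bounded for `|α|_p = 1`** (Mazur–Tate–Teitelbaum 1986, §I.11; Delbourgo 2008,
Thm. 2.2: "if `a_p(f)` is a `p`-adic unit then `μ_{f,α_p}` is a bounded measure"): with `D` the
common denominator of the `[r]⁺_f` (`exists_forall_ratPlusSymbol_eq_div`, Manin–Drinfeld) one has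
`|[r]⁺|_p ≤ |1/D|_p`, hence `|μ(a + pⁿℤ_p)|_p ≤ 2 |1/D|_p` as `|α⁻¹|_p = 1`; given Eichler–Shimura
and Manin–Drinfeld. [cite: Delbourgo2008, Thm. 2.2 (PDF p. 41)] -/
theorem exists_norm_msdMeasure_le_of_lattice (hES : isZLattice_periodLattice (f := f))
    (hMD : exists_nsmul_modularSymbol_mem_periodLattice f) (hf : IsNewform0 f)
    (hQ : coeffField f = ⊥) {α : ℚ_[p]} (hαu : ‖α‖ = 1) :
    ∃ C : ℝ, ∀ (n : ℕ) (a : ZMod (p ^ n)), ‖msdMeasure f α n a‖ ≤ C := by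
  obtain ⟨D, hD, hden⟩ := exists_forall_ratPlusSymbol_eq_div hES hMD hf hQ
  set C : ℝ := ‖(D : ℚ_[p])‖⁻¹ with hC
  have hC0 : 0 ≤ C := inv_nonneg.mpr (norm_nonneg _)
  have hbd : ∀ r : ℚ, ‖(ratPlusSymbol f r : ℚ_[p])‖ ≤ C := fun r ↦ by
    obtain ⟨m, hm⟩ := hden r
    rw [hm]
    push_cast
    rw [norm_div, div_eq_mul_inv]
    exact mul_le_of_le_one_left hC0 (Padic.norm_int_le_one m)
  have hαi : ‖α⁻¹‖ = 1 := by rw [norm_inv, hαu, inv_one]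
  refine ⟨2 * C, fun n a ↦ ?_⟩
  cases n with
  | zero =>
    simp only [msdMeasure]
    calc ‖(1 - α⁻¹) * (ratPlusSymbol f 0 : ℚ_[p])‖
        = ‖1 - α⁻¹‖ * ‖((ratPlusSymbol f 0 : ℚ) : ℚ_[p])‖ := norm_mul _ _
      _ ≤ (‖(1 : ℚ_[p])‖ + ‖α⁻¹‖) * C :=
          mul_le_mul (norm_sub_le _ _) (hbd 0) (norm_nonneg _) (by positivity)
      _ = 2 * C := by rw [norm_one, hαi]; ring
  | succ n =>
    simp only [msdMeasure]
    calc ‖α⁻¹ ^ (n + 1) * (ratPlusSymbol f ((a.val : ℚ) / (p : ℚ) ^ (n + 1)) : ℚ_[p]) -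
          α⁻¹ ^ (n + 2) * (ratPlusSymbol f ((a.val : ℚ) / (p : ℚ) ^ n) : ℚ_[p])‖
        ≤ ‖α⁻¹ ^ (n + 1) * (ratPlusSymbol f ((a.val : ℚ) / (p : ℚ) ^ (n + 1)) : ℚ_[p])‖ +
          ‖α⁻¹ ^ (n + 2) * (ratPlusSymbol f ((a.val : ℚ) / (p : ℚ) ^ n) : ℚ_[p])‖ :=
          norm_sub_le _ _
      _ ≤ C + C := by
          refine add_le_add ?_ ?_ <;>
          · rw [norm_mul, norm_pow, hαi, one_pow, one_mul]
            exact hbd _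
      _ = 2 * C := by ring

/-- **Reduction of the named fact `exists_norm_msdMeasure_le`** (boundedness of `μ_{f,α}` for the
unit root, stated here in unfolded form) to Eichler–Shimura and Manin–Drinfeld for `f`
(Mazur–Tate–Teitelbaum 1986, §I.11; Delbourgo 2008, Thm. 2.2). The hypotheses `p ∤ N`,
`a_p(f) = a_p`, `α² - a_p α + p = 0` of the named fact are not needed for boundedness.
[cite: Delbourgo2008, Thm. 2.2 (PDF p. 41)] -/
theorem exists_norm_msdMeasure_le_of (hES : isZLattice_periodLattice (f := f))
    (hMD : exists_nsmul_modularSymbol_mem_periodLattice f) :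
    ∀ (_ : IsNewform0 f) (_ : coeffField f = ⊥) (_ : ¬ p ∣ N) {ap : ℤ} (_ : cuspCoeff f p = ap)
      {α : ℚ_[p]} (_ : α ^ 2 - ap * α + p = 0) (_ : ‖α‖ = 1),
      ∃ C : ℝ, ∀ (n : ℕ) (a : ZMod (p ^ n)), ‖msdMeasure f α n a‖ ≤ C :=
  fun hf hQ _ _ _ _ _ hαu ↦ exists_norm_msdMeasure_le_of_lattice hES hMD hf hQ hαu

end Boundedness

end Literature.NumberTheory.EllipticCurves

namespace Literature.NumberTheory.EllipticCurves.ModularForms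

/-! ### The distribution relation of `μ_{f,α}` -/

section Distribution

variable {N : ℕ} [NeZero N] {p : ℕ} [Fact p.Prime]

/-- `[r + n]⁺ = [r]⁺` for `n ∈ ℤ`, from `{∞, r + n} = {∞, r}` (`modularSymbol_add_intCast_holds`).
[folklore] -/
theorem ratPlusSymbol_add_intCast_eq (f : CuspForm (Gamma0 N) 2) (r : ℚ) (n : ℤ) :
    ratPlusSymbol f (r + n) = ratPlusSymbol f r := by
  have h1 : modularSymbol f (r + n) = modularSymbol f r := by
    exact_mod_cast modularSymbol_add_intCast_holds f r n
  have h2 : modularSymbol f (-(r + n)) = modularSymbol f (-r) := by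
    have h := modularSymbol_add_intCast_holds f (-r) (-n)
    push_cast at h
    rw [← h]
    ring_nf
  have h3 : normalizedPlusSymbol f (r + n) = normalizedPlusSymbol f r := by
    simp only [normalizedPlusSymbol, plusSymbol, h1, h2]
  unfold ratPlusSymbol
  rw [h3]

/-- The fibre of `a mod p^n` in `ℤ/p^{n+1}` consists of the classes of `a + p^n j`, `j < p`.
[folklore] -/
theorem filter_castHom_eq_image (n : ℕ) (a : ZMod (p ^ n)) :
    Finset.univ.filter (fun b : ZMod (p ^ (n + 1)) ↦
        ZMod.castHom (pow_dvd_pow p n.le_succ) (ZMod (p ^ n)) b = a) =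
      Finset.univ.image (fun j : Fin p ↦ ((a.val + p ^ n * (j : ℕ) : ℕ) : ZMod (p ^ (n + 1)))) := by
  classical
  haveI : NeZero (p ^ n) := ⟨pow_ne_zero _ (Fact.out : p.Prime).ne_zero⟩
  haveI : NeZero (p ^ (n + 1)) := ⟨pow_ne_zero _ (Fact.out : p.Prime).ne_zero⟩
  have hp : 0 < p := (Fact.out : p.Prime).pos
  ext b
  simp only [Finset.mem_filter, Finset.mem_univ, true_and, Finset.mem_image]
  constructor
  · intro hb
    -- `b.val = a.val + p^n (b.val / p^n)` with `b.val / p^n < p`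
    have hba : b.val % p ^ n = a.val := by
      have h := congr_arg ZMod.val hb
      rwa [ZMod.castHom_apply, ZMod.cast_eq_val, ZMod.val_natCast] at h
    have hlt : b.val / p ^ n < p := by
      rw [Nat.div_lt_iff_lt_mul (pow_pos hp n)]
      calc b.val < p ^ (n + 1) := ZMod.val_lt b
        _ = p * p ^ n := by rw [pow_succ']
    refine ⟨⟨b.val / p ^ n, hlt⟩, ?_⟩
    dsimp only
    rw [← hba, Nat.mod_add_div, ZMod.natCast_zmod_val]
  · rintro ⟨j, rfl⟩
    rw [map_natCast, Nat.cast_add, Nat.cast_mul, ZMod.natCast_self, zero_mul, add_zero,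
      ZMod.natCast_zmod_val]

/-- The classes of `a + p^n j`, `j < p`, in `ℤ/p^{n+1}` are distinct, with
`val = a.val + p^n j`. [folklore] -/
theorem val_classLift (n : ℕ) (a : ZMod (p ^ n)) (j : Fin p) :
    (((a.val + p ^ n * (j : ℕ) : ℕ) : ZMod (p ^ (n + 1))).val = a.val + p ^ n * (j : ℕ)) := by
  haveI : NeZero (p ^ n) := ⟨pow_ne_zero _ (Fact.out : p.Prime).ne_zero⟩
  haveI : NeZero (p ^ (n + 1)) := ⟨pow_ne_zero _ (Fact.out : p.Prime).ne_zero⟩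
  refine ZMod.val_natCast_of_lt ?_
  have hp : 0 < p := (Fact.out : p.Prime).pos
  calc a.val + p ^ n * (j : ℕ) < p ^ n + p ^ n * (p - 1) := by
        have h1 := ZMod.val_lt a
        have h2 : p ^ n * (j : ℕ) ≤ p ^ n * (p - 1) := Nat.mul_le_mul_left _ (by omega)
        omega
    _ = p ^ (n + 1) := by
        rw [pow_succ]
        have : 1 ≤ p := hp
        zify [this]
        ring

/-- **The distribution relation of `μ_{f,α}`** (Mazur–Tate–Teitelbaum 1986, §I.10,
Prop. (10.2); Mazur–Swinnerton-Dyer 1974, §8): for a rational normalised newform `f` of level `N`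
prime to `p`, `a_p(f) = a_p ∈ ℤ` and `α ≠ 0` with `α² - a_p α + p = 0`,
`∑_{b ≡ a mod pⁿ} μ(b + pⁿ⁺¹ℤ_p) = μ(a + pⁿℤ_p)`. Proof: the classes over `a` are `a + pⁿ j`,
`j < p`; with `x = a/pⁿ`, `∑ⱼ [(a + pⁿ j)/pⁿ⁺¹]⁺ = ∑ⱼ [(x + j)/p]⁺ = a_p [x]⁺ - [p x]⁺` (the Hecke
relation (4.2), `intCast_mul_ratPlusSymbol`, needing `T_p f = a_p f`
(`IsNewform0.heckeEigenvalue_eq_coeff_holds`) and the rationality `([r]⁺ : ℝ) = [r]` of the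
rational plus symbols of `f`, hypothesis `hrat` — Manin–Drinfeld, see
`ratCast_ratPlusSymbol_of_lattice`) and `∑ⱼ [(a + pⁿ j)/pⁿ]⁺ = p [x]⁺` (`[x + j]⁺ = [x]⁺`); the
relation then reduces to `α⁻¹ a_p - p α⁻² = 1`, i.e. `α² - a_p α + p = 0`. This is the body of the
named fact `msdMeasure_distribution` for the given `f`.
[cite: MazurTateTeitelbaum1986Invent, §I.10 Prop. (10.2)] -/
theorem sum_fiber_msdMeasure_succ_eq {f : CuspForm (Gamma0 N) 2}
    (hrat : ∀ r : ℚ, (ratPlusSymbol f r : ℝ) = normalizedPlusSymbol f r) (hf : IsNewform0 f)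
    (hpN : ¬ p ∣ N) {ap : ℤ} (hap : cuspCoeff f p = ap) {α : ℚ_[p]} (hα₀ : α ≠ 0)
    (hα : α ^ 2 - ap * α + p = 0) (n : ℕ) (a : ZMod (p ^ n)) :
    ∑ b ∈ Finset.univ.filter (fun b : ZMod (p ^ (n + 1)) ↦
        ZMod.castHom (pow_dvd_pow p n.le_succ) (ZMod (p ^ n)) b = a), msdMeasure f α (n + 1) b =
      msdMeasure f α n a := by
  classical
  haveI : NeZero p := ⟨(Fact.out : p.Prime).ne_zero⟩
  have hp : p.Prime := Fact.out
  have hp0 : (p : ℚ) ≠ 0 := by exact_mod_cast hp.ne_zero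
  -- the fibre and its parametrisation
  have hinj : Function.Injective
      (fun j : Fin p ↦ ((a.val + p ^ n * (j : ℕ) : ℕ) : ZMod (p ^ (n + 1)))) := by
    intro j j' h
    have hv := congr_arg ZMod.val h
    simp only [val_classLift] at hv
    exact Fin.ext (Nat.eq_of_mul_eq_mul_left (pow_pos hp.pos n) (by omega))
  rw [filter_castHom_eq_image, Finset.sum_image fun j _ j' _ h ↦ hinj h]
  -- the two rational sums
  set x : ℚ := (a.val : ℚ) / (p : ℚ) ^ n with hx
  have hA : ∀ j : Fin p, ((a.val + p ^ n * (j : ℕ) : ℕ) : ℚ) / (p : ℚ) ^ (n + 1) = (x + j) / p := by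
    intro j
    rw [hx]
    push_cast
    field_simp
    ring
  have hB : ∀ j : Fin p, ratPlusSymbol f (((a.val + p ^ n * (j : ℕ) : ℕ) : ℚ) / (p : ℚ) ^ n) =
      ratPlusSymbol f x := by
    intro j
    have : ((a.val + p ^ n * (j : ℕ) : ℕ) : ℚ) / (p : ℚ) ^ n = x + ((j : ℕ) : ℤ) := by
      rw [hx]
      push_cast
      field_simp
    rw [this, ratPlusSymbol_add_intCast_eq]
  have hHecke := intCast_mul_ratPlusSymbol p hf hp hpN hap hrat x
  -- the key identity `α⁻¹ a_p - p α⁻² = 1`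
  have hkey : α⁻¹ * (ap : ℚ_[p]) - (p : ℚ_[p]) * α⁻¹ ^ 2 = 1 := by
    field_simp
    linear_combination -hα
  -- evaluate the sum over the fibre
  have hsumq : ∑ j : Fin p, ratPlusSymbol f ((x + j) / p) =
      (ap : ℚ) * ratPlusSymbol f x - ratPlusSymbol f (p * x) := eq_sub_of_add_eq hHecke.symm
  have hsum : ∑ j : Fin p,
      msdMeasure f α (n + 1) ((a.val + p ^ n * (j : ℕ) : ℕ) : ZMod (p ^ (n + 1))) =
      α⁻¹ ^ (n + 1) * ((ap : ℚ_[p]) * (ratPlusSymbol f x : ℚ_[p]) -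
          (ratPlusSymbol f (p * x) : ℚ_[p])) -
        α⁻¹ ^ (n + 2) * ((p : ℚ_[p]) * (ratPlusSymbol f x : ℚ_[p])) := by
    calc _ = ∑ j : Fin p, (α⁻¹ ^ (n + 1) * (ratPlusSymbol f ((x + j) / p) : ℚ_[p]) -
          α⁻¹ ^ (n + 2) * (ratPlusSymbol f x : ℚ_[p])) := by
          refine Finset.sum_congr rfl fun j _ ↦ ?_
          simp only [msdMeasure, val_classLift, hA, hB]
      _ = α⁻¹ ^ (n + 1) * ((∑ j : Fin p, ratPlusSymbol f ((x + j) / p) : ℚ) : ℚ_[p]) -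
          α⁻¹ ^ (n + 2) * ((p : ℚ_[p]) * (ratPlusSymbol f x : ℚ_[p])) := by
          rw [Finset.sum_sub_distrib, ← Finset.mul_sum, ← Finset.mul_sum, Rat.cast_sum,
            Finset.sum_const, Finset.card_univ, Fintype.card_fin, nsmul_eq_mul]
      _ = _ := by
          rw [hsumq]
          push_cast
          ring
  rw [hsum]
  -- compare with `μ(a + pⁿ ℤ_p)`
  cases n with
  | zero =>
    haveI : Subsingleton (ZMod (p ^ 0)) := (ZMod.subsingleton_iff).mpr (pow_zero p)
    have ha : a.val = 0 := by
      rw [Subsingleton.elim a 0, ZMod.val_zero]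
    have hx0 : x = 0 := by rw [hx, ha]; simp
    have hpx : ratPlusSymbol f (p * x) = ratPlusSymbol f 0 := by rw [hx0, mul_zero]
    rw [hpx, hx0]
    simp only [msdMeasure]
    linear_combination (ratPlusSymbol f 0 : ℚ_[p]) * hkey
  | succ m =>
    have hpx : (p : ℚ) * x = (a.val : ℚ) / (p : ℚ) ^ m := by
      rw [hx, show ((p : ℚ)) ^ (m + 1) = (p : ℚ) ^ m * p from pow_succ _ _]
      field_simp
    rw [hpx]
    simp only [msdMeasure]
    rw [← hx]
    linear_combination (α⁻¹ ^ (m + 1) * (ratPlusSymbol f x : ℚ_[p])) * hkey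

end Distribution

/-! ### The named facts `ratCast_ratPlusSymbol` and `msdMeasure_distribution` -/

section Facts

variable {N : ℕ} {p : ℕ} [Fact p.Prime]

/-- **Reduction of the named fact `ratCast_ratPlusSymbol`** (level `N`) to Eichler–Shimura and
Manin–Drinfeld for the cusp forms of level `N` (Mazur–Tate–Teitelbaum 1986, §I.8). (The
hypotheses quantify over the instance `[NeZero N]` exactly as the named facts do.)
[cite: MazurTateTeitelbaum1986Invent, §I.8] -/
theorem ratCast_ratPlusSymbol_of
    (hES : ∀ [NeZero N] {g : CuspForm (Gamma0 N) 2}, isZLattice_periodLattice (f := g))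
    (hMD : ∀ [NeZero N] (g : CuspForm (Gamma0 N) 2),
      exists_nsmul_modularSymbol_mem_periodLattice g) :
    ratCast_ratPlusSymbol (N := N) := by
  intro _ g hg hQ r
  exact ratCast_ratPlusSymbol_of_lattice hES (hMD g) hg hQ r

/-- **Reduction of the named fact `msdMeasure_distribution`** (the distribution relation of
`μ_{f,α}` for the rational newforms of level `N`; Mazur–Tate–Teitelbaum 1986, §I.10 Prop. (10.2))
to Eichler–Shimura (`isZLattice_periodLattice`) and Manin–Drinfeld
(`exists_nsmul_modularSymbol_mem_periodLattice`) for the cusp forms of level `N`, which give the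
rationality `([r]⁺ : ℝ) = [r]` (`ratCast_ratPlusSymbol_of_lattice`); the Hecke relation and the
`T_p`-eigenvalue are theorems (`cuspCoeff_mul_modularSymbol`,
`IsNewform0.heckeEigenvalue_eq_coeff_holds`). (The hypotheses quantify over the instance
`[NeZero N]` exactly as the named facts do.)
[cite: MazurTateTeitelbaum1986Invent, §I.10 Prop. (10.2)] -/
theorem msdMeasure_distribution_of
    (hES : ∀ [NeZero N] {g : CuspForm (Gamma0 N) 2}, isZLattice_periodLattice (f := g))
    (hMD : ∀ [NeZero N] (g : CuspForm (Gamma0 N) 2),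
      exists_nsmul_modularSymbol_mem_periodLattice g) :
    msdMeasure_distribution (N := N) (p := p) := by
  intro _ g hg hQ hpN _ hap _ hα₀ hα n a
  exact sum_fiber_msdMeasure_succ_eq (fun r ↦ ratCast_ratPlusSymbol_of_lattice hES (hMD g) hg hQ r)
    hg hpN hap hα₀ hα n a

end Facts

end Literature.NumberTheory.EllipticCurves.ModularForms
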